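import Literature.AlgebraicGeometry.HodgeTheory.DiagonalSymmetryHyperplaneLine
import Literature.AlgebraicGeometry.HodgeTheory.FermatSurfaceLineRestrictions
import HarnessLib

/-!
# Eigen-Hodge numbers of a diagonal symmetry of a smooth hypersurface: the INVARIANT eigenvalue in
# even dimension, Jacobian range (Voisin II Thm. 6.10 / Cor. 6.12 read equivariantly, with the
# primitivity of the residues; Carlson–Toledo 1999 §5)

Family `hodge`, layer `Literature/AlgebraicGeometry/HodgeTheory`. PROOF FILE (theorems only; no definition,
no named fact). Sequel of `DiagonalSymmetryEigenHodgeNumbersAllDimensions` (which left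
`-- TODO(general form): μ = 1 with invariant numerators present (needs primitivity of residues)`) and of
`DiagonalSymmetryHyperplaneLine` (`L = ℂ·h^m ⊆ H^{m,m}`, `dim L = 1`). The primitivity clause is now typed
(`GriffithsResiduesPrimitive`, clause (v) of `IsGriffithsResiduePackage`: `ι^*ω ∪ res_l(P) = 0`), and this
file proves, for a smooth hypersurface `Y = V₊(F) ⊂ ℙ^{2m+1}` of EVEN dimension `n = 2m ≥ 2`, a diagonal
symmetry `σ_a` and the eigenvalue `μ = 1`:

* **`finrank_eigenspace_one_inf_piece_eq_of_residues_primitive`** — granted the package with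
  primitivity, for `q ≤ n`, `k + (n + 2) = (q + 1) d`:
  `dim_ℂ (ker(σ_a^* ⊗ ℂ − 1) ∩ H^{n−q,q}(Y)) = dim_ℂ (S^k)₁ − dim_ℂ (J_F^k)₁ + [q = m]` (the `1`-eigenspaces
  of the twisted action `T_a P = (∏ aᵢ) P(a • x)`; stated additively). Proof:
  `E₁ ∩ F^{n−q} = res((S^k)₁) ⊕ (L ∩ F^{n−q})` and `E₁ ∩ F^{n−q+1} = res((J^k)₁) ⊕ (L ∩ F^{n−q+1})`, the
  sums being direct because the residues are PRIMITIVE (`ι^*ω ∪ res = 0`) while `L_h` is injective on `L`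
  (`lefschetzOperator_eq_zero_imp_eq_zero_of_mem_range`); the second identity uses clause (ii) at the
  level `l = q` to separate `L` from the residues; then the rank–nullity count of the odd-dimensional file
  and `dim (L ∩ F^{n−q}) − dim (L ∩ F^{n−q+1}) = [q = m]`.

Written by the prover seat `hodge-nonav-prover-Bx` (cell `hodge-nonav`) towards the derivation of the
named fact `voisin2003_finrank_eigenspace_inf_hodgePiece_of_diagonalStabilizer` (binder
`stub_voisinEigenHodgeNumbers` of crux K1-B of `Summits/HodgeConjecture/HodgeConjecture/Theses/SignSymmetricPowers.lean`)
from `Griffiths1969_residues_primitive`.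

## References
* [VoisinHodgeII2003] C. Voisin, Hodge Theory and Complex Algebraic Geometry II, CUP 2003, §6.1.3
  (`α_p`), Rem. 6.8, Thm. 6.10, Cor. 6.12 (held text chunks p0159, p0161); §1.2.3 Cor. 1.24–1.25.
* [CarlsonToledo1999] J. A. Carlson, D. Toledo, Duke Math. J. 97 (1999), §2 (held text p0005), §5.
-/

noncomputable section

open CategoryTheory AlgebraicGeometry MvPolynomial
open scoped TensorProduct

namespace Literature.AlgebraicGeometry.HodgeTheory

open Literature.AlgebraicGeometry.Motives Literature.AlgebraicTopology.SingularHomology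
open Literature.RingTheory.MvPolynomial (idealDegree mem_idealDegree)
open Literature.Geometry.Kaehler (lefschetzOperator)

section HodgeTheory

variable {n d : ℕ} {F : MvPolynomial (Fin (n + 2)) ℂ}

/-! ### §1 The invariant eigen-Hodge numbers in even dimension -/

/-- **The eigen-Hodge numbers of a diagonal symmetry of a smooth hypersurface at the INVARIANT
eigenvalue `μ = 1`, even dimension `n = 2m ≥ 2`** (Voisin II Cor. 6.12 with the naturality of the
residue and its PRIMITIVITY, granted the package `Griffiths1969_residues_primitive`): for `a` in the
diagonal stabiliser of the irreducible form `F`, `σ_a = diagonalAut F ha`, `q ≤ n`, `k + (n + 2) = (q + 1) d`: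
`dim_ℂ (ker(σ_a^* ⊗ ℂ − 1) ∩ H^{n−q,q}(Y)) = dim_ℂ (S^k)₁ − dim_ℂ (J_F^k)₁ + [q = m]` (the `1`-eigenspaces of
the twisted action `T_a`). The extra `1` at `q = m` is the hyperplane class `h^m ∈ H^{m,m}`; everywhere else
`E₁ ∩ F^{n−q} = res((S^k)₁) ⊕ (L ∩ F^{n−q})`, the residues being primitive and `L_h` injective on `L`.
[cite: VoisinHodgeII2003, §6.1.3 (α_p), Rem. 6.8, Thm. 6.10 and Cor. 6.12 (held text chunks p0159, p0161)]
[cite: CarlsonToledo1999, §5 (held text p0011–p0012)] -/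
theorem finrank_eigenspace_one_inf_piece_eq_of_residues_primitive
    (hG : Griffiths1969_residues_primitive)
    (hHD : exists_isReal_hodgeModel) (hI : hodgePQ_independent_of_hodgeModel)
    {m : ℕ} (hnm : n = 2 * m) (hm : 1 ≤ m) (hF : F.IsHomogeneous d) (hirr : Irreducible F)
    (hJ : ∀ z : Fin (n + 2) → ℂ, z ≠ 0 → MvPolynomial.eval z F = 0 →
      ∃ j, MvPolynomial.eval z (MvPolynomial.pderiv j F) ≠ 0)
    (hX : IsSmoothProjective n (SmoothHypersurface.hypersurface F))
    {a : Fin (n + 2) → ℂˣ} (ha : a ∈ diagonalStabilizer F)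
    {q k : ℕ} (hq : q ≤ n) (hk : k + (n + 2) = (q + 1) * d) :
    Module.finrank ℂ ↥(Module.End.eigenspace ((BettiUniverse.pull (diagonalAut F ha) n).baseChange ℂ) 1 ⊓
        (BettiUniverse.hodge hHD hX n).piece ((n : ℤ) - q) q) +
      Module.finrank ℂ ↥(Module.End.eigenspace (twistedDiagonalAction a) 1 ⊓
          idealDegree (UniversalHypersurface.jacobianIdeal F) k) =
      Module.finrank ℂ ↥(Module.End.eigenspace (twistedDiagonalAction a) 1 ⊓
          homogeneousSubmodule (Fin (n + 2)) ℂ k) + (if q = m then 1 else 0) := by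
  classical
  have hn1 : 1 ≤ n := by omega
  -- the data
  set X := SmoothHypersurface.hypersurface F with hXdef
  set ι := SmoothHypersurface.hypersurfaceι F with hιdef
  set A := BettiUniverse.realHodgeModel hHD hX with hAdef
  set H := BettiUniverse.hodge hHD hX n with hHdef
  set gC := (BettiUniverse.pull (diagonalAut F ha) n).baseChange ℂ with hgC
  set T := twistedDiagonalAction a with hTdef
  set Sk := homogeneousSubmodule (Fin (n + 2)) ℂ k with hSk
  set J := UniversalHypersurface.jacobianIdeal F with hJdef
  obtain ⟨res, hpack⟩ := hG n d hn1 F hF hJ hX A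
  have h1 := hpack.filtration
  have h2 := hpack.span
  have h3 := hpack.equivariant
  have h4 := hpack.kernel
  set β := ofRatClassBaseChangeEquiv hX n with hβ
  set L : Submodule ℂ (ℂ ⊗[ℚ] ↥(bettiCohomology X n)) :=
    (LinearMap.range (complexBetti.map ι n).hom).map β.symm.toLinearMap with hLdef
  set ρ : MvPolynomial (Fin (n + 2)) ℂ →ₗ[ℂ] ℂ ⊗[ℚ] ↥(bettiCohomology X n) :=
    β.symm.toLinearMap ∘ₗ res (q + 1) with hρ
  have hl1 : 1 ≤ q + 1 := Nat.le_add_left 1 q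
  have hln : q + 1 ≤ n + 1 := Nat.add_le_add_right hq 1
  -- finite-dimensionality
  haveI : Module.Finite ℚ ↥(bettiCohomology X n) := BettiUniverse.finite hX n
  haveI : Module.Finite ℂ ↥Sk := Module.Finite.iff_fg.mpr (homogeneousSubmodule_fg (Fin (n + 2)) ℂ k)
  -- (L0) the hyperplane line
  obtain ⟨hLF, hLF1, hLdim⟩ := hyperplaneClasses_le_F_and_disjoint_and_finrank hHD hX hF hirr hnm
  -- (L1) membership in the Hodge filtration of `H` read in the model `A`
  have memF : ∀ (j : ℕ) (x : ℂ ⊗[ℚ] ↥(bettiCohomology X n)),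
      x ∈ H.F (j : ℤ) ↔ A.pullback n (β x) ∈ A.hodgeFiltration n j := by
    intro j x
    rw [hHdef, BettiUniverse.hodge_F, HodgeModel.mem_ratF_iff, Int.toNat_natCast]
    rfl
  have hβρ : ∀ P, β (ρ P) = res (q + 1) P := fun P ↦ by
    rw [hρ, LinearMap.comp_apply, LinearEquiv.coe_toLinearMap, LinearEquiv.apply_symm_apply]
  -- indices
  have hidx1 : n + 1 - (q + 1) = n - q := by omega
  have hidx2 : n + 2 - (q + 1) = n - q + 1 := by omega
  have hp : ((n - q : ℕ) : ℤ) = (n : ℤ) - q := by omega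
  have hp1 : ((n - q + 1 : ℕ) : ℤ) = (n : ℤ) - q + 1 := by omega
  -- (L2) equivariance: `gC (ρ P) = ρ (T P)`
  have hβg : ∀ y, β (gC y) = complexBetti.map (diagonalAut F ha) n (β y) := fun y ↦
    HodgeModel.ofRatClassBaseChange_baseChange_map (diagonalAut F ha) n y
  have hequiv : ∀ P ∈ Sk, gC (ρ P) = ρ (T P) := by
    intro P hP
    apply β.injective
    rw [hβg, hβρ, hβρ, hTdef, twistedDiagonalAction_apply, map_smul]
    exact h3 a ha (q + 1) k P hl1 hln hk ((mem_homogeneousSubmodule k P).mp hP)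
  -- the hyperplane classes are invariant
  have hL1 : ∀ y ∈ L, gC y = y := fun y hy ↦
    baseChange_pull_diagonalAut_eq_self_of_mem_hyperplaneClasses hX ha n hy
  -- eigenvectors of `T` in `S^k` go to eigenvectors of `gC`
  have heig : ∀ (ν : ℂ) (P : MvPolynomial (Fin (n + 2)) ℂ), P ∈ Module.End.eigenspace T ν → P ∈ Sk →
      ρ P ∈ Module.End.eigenspace gC ν := by
    intro ν P hPν hP
    rw [Module.End.mem_eigenspace_iff, hequiv P hP, Module.End.mem_eigenspace_iff.mp hPν, map_smul]
  -- (i') `ρ(S^k) ⊆ F^{n-q}`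
  have hρF : ∀ P ∈ Sk, ρ P ∈ H.F ((n : ℤ) - q) := by
    intro P hP
    rw [← hp, memF, hβρ, ← hidx1]
    exact h1 (q + 1) k P hl1 hln hk ((mem_homogeneousSubmodule k P).mp hP)
  -- (iv') `ρ P ∈ F^{n-q+1} ↔ P ∈ J` on `S^k`
  have hρF1 : ∀ P ∈ Sk, (ρ P ∈ H.F ((n : ℤ) - q + 1) ↔ P ∈ J) := by
    intro P hP
    rw [← hp1, memF, hβρ, ← hidx2]
    exact h4 (q + 1) k P hl1 hln hk ((mem_homogeneousSubmodule k P).mp hP)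
  -- (ii') `F^{n-q} ⊆ ρ(S^k) + L`
  have hFρ : ∀ x ∈ H.F ((n : ℤ) - q), ∃ P ∈ Sk, ∃ y ∈ L, ρ P + y = x := by
    intro x hx
    rw [← hp, memF, ← hidx1] at hx
    have h2x := h2 (q + 1) hl1 hln (β x) hx
    have hsup : (⨆ (k' : ℕ) (_ : k' + (n + 2) = (q + 1) * d),
        (homogeneousSubmodule (Fin (n + 2)) ℂ k').map (res (q + 1))) = Sk.map (res (q + 1)) := by
      refine le_antisymm (iSup_le fun k' ↦ iSup_le fun hk' ↦ ?_) (le_iSup_of_le k (le_iSup_of_le hk le_rfl))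
      obtain rfl : k' = k := by omega
      exact le_rfl
    rw [hsup] at h2x
    obtain ⟨u, hu, z, hz, huz⟩ := Submodule.mem_sup.mp h2x
    obtain ⟨P, hP, rfl⟩ := Submodule.mem_map.mp hu
    refine ⟨P, hP, β.symm z, Submodule.mem_map_of_mem hz, ?_⟩
    apply β.injective
    rw [map_add, hβρ, LinearEquiv.apply_symm_apply, huz]
  -- (v') PRIMITIVITY: a Kähler class `ω`, the primitive classes `Prim`, `ρ(S^k) ⊆ Prim`, `L ∩ Prim = 0`
  obtain ⟨ω, hω⟩ := FermatSurface.exists_complexBetti_projectiveSpace_ne_zero (n + 1) (by omega)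
  set Prim : Submodule ℂ (ℂ ⊗[ℚ] ↥(bettiCohomology X n)) :=
    (LinearMap.ker (lefschetzOperator (complexBetti.map ι 2 ω) (Nat.add_comm 2 n))).comap
      β.toLinearMap with hPrim
  have hmemPrim : ∀ x, x ∈ Prim ↔ lefschetzOperator (complexBetti.map ι 2 ω) (Nat.add_comm 2 n) (β x) = 0 :=
    fun x ↦ Iff.rfl
  have hresPrim : ∀ (l k' : ℕ) (P : MvPolynomial (Fin (n + 2)) ℂ), 1 ≤ l → l ≤ n + 1 →
      k' + (n + 2) = l * d → P ∈ homogeneousSubmodule (Fin (n + 2)) ℂ k' → β.symm (res l P) ∈ Prim := by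
    intro l k' P hl hl' hk' hP
    rw [hmemPrim, LinearEquiv.apply_symm_apply]
    exact hpack.primitive ω l k' P hl hl' hk' ((mem_homogeneousSubmodule k' P).mp hP)
  have hρPrim : ∀ P ∈ Sk, ρ P ∈ Prim := fun P hP ↦ hresPrim (q + 1) k P hl1 hln hk hP
  have hLPrim : ∀ y ∈ L, y ∈ Prim → y = 0 := by
    intro y hy hyP
    obtain ⟨z, hz, rfl⟩ := Submodule.mem_map.mp hy
    have h0 := lefschetzOperator_eq_zero_imp_eq_zero_of_mem_range hX hF hirr hnm hm hω z hz
      (by rw [hmemPrim] at hyP; simpa using hyP)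
    rw [h0, map_zero]
  -- the eigen-subspaces of polynomials
  set S1 := Module.End.eigenspace T 1 ⊓ Sk with hS1
  set J1 := Module.End.eigenspace T 1 ⊓ idealDegree J k with hJ1
  have hJ1_le : J1 ≤ S1 := inf_le_inf_left _ inf_le_right
  -- (X1) `E_1 ∩ F^{n-q} = ρ(S^k_1) ⊔ (L ∩ F^{n-q})`
  have X1 : Module.End.eigenspace gC 1 ⊓ H.F ((n : ℤ) - q) = S1.map ρ ⊔ (L ⊓ H.F ((n : ℤ) - q)) := by
    refine le_antisymm ?_ ?_
    · rintro x ⟨hxE, hxF⟩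
      obtain ⟨P, hP, y, hy, hPyx⟩ := hFρ x hxF
      -- decompose `P` into `T`-eigencomponents, and add `y` to the `1`-component
      set s := P.support.image (diagonalCharacter a) with hs
      set xf : ℂ → ℂ ⊗[ℚ] ↥(bettiCohomology X n) :=
        fun ν ↦ ρ (eigenComponent a ν P) + if ν = 1 then y else 0 with hxf
      have hsumP : ∑ ν ∈ insert (1 : ℂ) s, ρ (eigenComponent a ν P) = ρ P := by
        by_cases h1s : (1 : ℂ) ∈ s
        · rw [Finset.insert_eq_of_mem h1s, ← map_sum, sum_eigenComponent a P]
        · rw [Finset.sum_insert h1s, eigenComponent_eq_zero_of_not_mem a h1s, map_zero, zero_add,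
            ← map_sum, sum_eigenComponent a P]
      have hsumy : ∑ ν ∈ insert (1 : ℂ) s, (if ν = 1 then y else 0) = y := by
        rw [Finset.sum_ite_eq' (insert (1 : ℂ) s) (1 : ℂ) (fun _ ↦ y), if_pos (Finset.mem_insert_self _ _)]
      have hsum : x = ∑ ν ∈ insert (1 : ℂ) s, xf ν := by
        rw [hxf, Finset.sum_add_distrib, hsumP, hsumy, hPyx]
      have hterms : ∀ ν ∈ insert (1 : ℂ) s, xf ν ∈ Module.End.eigenspace gC ν := by
        intro ν _
        refine Submodule.add_mem _ (heig ν _ (eigenComponent_mem_eigenspace a ν P)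
          (eigenComponent_mem_homogeneousSubmodule a ν hP)) ?_
        split_ifs with hν1
        · rw [hν1, Module.End.mem_eigenspace_iff, one_smul]
          exact hL1 y hy
        · exact Submodule.zero_mem _
      have hxE' : ∑ ν ∈ insert (1 : ℂ) s, xf ν ∈ Module.End.eigenspace gC 1 := hsum ▸ hxE
      have key := sum_eq_of_sum_mem_eigenspace gC (insert (1 : ℂ) s) xf hterms hxE'
      rw [← hsum, if_pos (Finset.mem_insert_self _ _)] at key
      -- `x = ρ(P_1) + y`
      have hP1 : eigenComponent a 1 P ∈ S1 :=
        ⟨eigenComponent_mem_eigenspace a 1 P, eigenComponent_mem_homogeneousSubmodule a 1 hP⟩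
      have hyF : y ∈ H.F ((n : ℤ) - q) := by
        have : y = x - ρ (eigenComponent a 1 P) := by
          rw [key, hxf]; dsimp only; rw [if_pos rfl]; abel
        rw [this]
        exact Submodule.sub_mem _ hxF (hρF _ hP1.2)
      rw [key, hxf]
      dsimp only
      rw [if_pos rfl]
      exact Submodule.add_mem_sup (Submodule.mem_map_of_mem hP1) ⟨hy, hyF⟩
    · refine sup_le ?_ ?_
      · rintro _ ⟨P, ⟨hPμ, hP⟩, rfl⟩
        exact ⟨heig 1 P hPμ hP, hρF P hP⟩
      · rintro y ⟨hy, hyF⟩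
        refine ⟨?_, hyF⟩
        rw [SetLike.mem_coe, Module.End.mem_eigenspace_iff, one_smul]
        exact hL1 y hy
  -- (X2) `E_1 ∩ F^{n-q+1} = ρ(J^k_1) ⊔ (L ∩ F^{n-q+1})`
  have X2 : Module.End.eigenspace gC 1 ⊓ H.F ((n : ℤ) - q + 1) = J1.map ρ ⊔ (L ⊓ H.F ((n : ℤ) - q + 1)) := by
    refine le_antisymm ?_ ?_
    · rintro x ⟨hxE, hxF1⟩
      have hxF : x ∈ H.F ((n : ℤ) - q) := H.antitone_F (by omega) hxF1
      have hx1 : x ∈ Module.End.eigenspace gC 1 ⊓ H.F ((n : ℤ) - q) := ⟨hxE, hxF⟩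
      rw [X1] at hx1
      obtain ⟨u, hu, y, ⟨hy, hyF⟩, rfl⟩ := Submodule.mem_sup.mp hx1
      obtain ⟨P, hPS1, rfl⟩ := Submodule.mem_map.mp hu
      -- separate `ρ P` from `y` inside `F^{n-q+1}`: clause (ii) at the level `l = q`
      rcases Nat.eq_zero_or_pos q with hq0 | hqpos
      · -- `q = 0`: `F^{n+1} = 0`, so `x = 0`
        have hbot : H.F ((n : ℤ) - q + 1) = ⊥ := by
          rw [hHdef, BettiUniverse.hodge_F]
          exact HodgeModel.ratF_eq_bot _ hX n (by omega)
        have hx0 : ρ P + y ∈ (⊥ : Submodule ℂ (ℂ ⊗[ℚ] ↥(bettiCohomology X n))) := hbot ▸ hxF1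
        rw [Submodule.mem_bot] at hx0
        rw [hx0]
        exact Submodule.zero_mem _
      · have hl1' : 1 ≤ q := hqpos
        have hln' : q ≤ n + 1 := by omega
        have hidx1' : n + 1 - q = n - q + 1 := by omega
        have hxF1' : A.pullback n (β (ρ P + y)) ∈ A.hodgeFiltration n (n + 1 - q) := by
          rw [hidx1', ← memF, hp1]; exact hxF1
        have h2x := h2 q hl1' hln' (β (ρ P + y)) hxF1'
        obtain ⟨u', hu', z', hz', huz'⟩ := Submodule.mem_sup.mp h2x
        -- `u'` is primitive and in `F^{n-q+1}`; `z'` is a hyperplane class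
        have hsub : (⨆ (k' : ℕ) (_ : k' + (n + 2) = q * d),
            (homogeneousSubmodule (Fin (n + 2)) ℂ k').map (res q)) ≤
            (Prim ⊓ H.F ((n : ℤ) - q + 1)).comap β.symm.toLinearMap := by
          refine iSup_le fun k' ↦ iSup_le fun hk' ↦ ?_
          rintro _ ⟨P', hP', rfl⟩
          refine ⟨hresPrim q k' P' hl1' hln' hk' hP', ?_⟩
          change β.symm (res q P') ∈ H.F ((n : ℤ) - q + 1)
          rw [← hp1, memF, LinearEquiv.apply_symm_apply, ← hidx1']
          exact h1 q k' P' hl1' hln' hk' ((mem_homogeneousSubmodule k' P').mp hP')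
        have hu'Prim : β.symm u' ∈ Prim := (hsub hu').1
        have hu'F : β.symm u' ∈ H.F ((n : ℤ) - q + 1) := (hsub hu').2
        have hz'L : β.symm z' ∈ L := Submodule.mem_map_of_mem hz'
        -- `ρ P - β⁻¹ u' = β⁻¹ z' - y ∈ Prim ∩ L = 0`
        have hdiff : ρ P - β.symm u' = β.symm z' - y := by
          have : ρ P + y = β.symm u' + β.symm z' := by
            apply β.injective
            rw [map_add β (β.symm u') (β.symm z'), LinearEquiv.apply_symm_apply,
              LinearEquiv.apply_symm_apply]
            exact huz'.symm
          rw [sub_eq_sub_iff_add_eq_add, this]; abel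
        have hzero : β.symm z' - y = 0 :=
          hLPrim _ (Submodule.sub_mem _ hz'L hy)
            (by rw [← hdiff]; exact Submodule.sub_mem _ (hρPrim P hPS1.2) hu'Prim)
        have hyeq : y = β.symm z' := (sub_eq_zero.mp hzero).symm
        have hρPeq : ρ P = β.symm u' := by
          have := hdiff; rw [hzero, sub_eq_zero] at this; exact this
        have hPJ : P ∈ J := (hρF1 P hPS1.2).mp (hρPeq ▸ hu'F)
        have hyF1 : y ∈ H.F ((n : ℤ) - q + 1) := by
          have : y = (ρ P + y) - ρ P := by abel
          rw [this]
          exact Submodule.sub_mem _ hxF1 (hρPeq ▸ hu'F)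
        exact Submodule.add_mem_sup (Submodule.mem_map_of_mem ⟨hPS1.1, hPJ, hPS1.2⟩) ⟨hy, hyF1⟩
    · refine sup_le ?_ ?_
      · rintro _ ⟨P, ⟨hPμ, hPJ, hP⟩, rfl⟩
        exact ⟨heig 1 P hPμ hP, (hρF1 P hP).mpr hPJ⟩
      · rintro y ⟨hy, hyF⟩
        refine ⟨?_, hyF⟩
        rw [SetLike.mem_coe, Module.End.mem_eigenspace_iff, one_smul]
        exact hL1 y hy
  -- (X3) `S^k_1 ∩ ker ρ = J^k_1 ∩ ker ρ`
  have X3 : S1 ⊓ LinearMap.ker ρ = J1 ⊓ LinearMap.ker ρ := by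
    refine le_antisymm ?_ (inf_le_inf_right _ hJ1_le)
    rintro P ⟨⟨hPμ, hP⟩, hPker⟩
    refine ⟨⟨hPμ, ?_, hP⟩, hPker⟩
    refine (hρF1 P hP).mp ?_
    have h0 : ρ P = 0 := LinearMap.mem_ker.mp hPker
    rw [h0]
    exact Submodule.zero_mem _
  -- (X4) `dim (E_1 ∩ F^{n-q}) = dim (E_1 ∩ V^{n-q,q}) + dim (E_1 ∩ F^{n-q+1})`
  have hpiece : H.F ((n : ℤ) - q) = H.F ((n : ℤ) - q + 1) ⊔ H.piece ((n : ℤ) - q) q := by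
    have h := Motives.HodgeStructure.F_eq_F_succ_sup_piece H ((n : ℤ) - q)
    rwa [show (n : ℤ) - ((n : ℤ) - q) = q by ring] at h
  have hdisj : Disjoint (H.F ((n : ℤ) - q + 1)) (H.piece ((n : ℤ) - q) q) := by
    rw [disjoint_iff, inf_comm]
    have h := Motives.HodgeStructure.piece_inf_F_succ_sup_complexConj_eq_bot H ((n : ℤ) - q)
    rw [show (n : ℤ) - ((n : ℤ) - q) = q by ring] at h
    refine le_bot_iff.mp (le_trans (inf_le_inf_left _ le_sup_left) h.le)
  set gH := BettiUniverse.pullHodgeHom hHD hI hX hX (diagonalAut F ha) n with hgH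
  have hgH' : gH.toLinearMap.baseChange ℂ = gC := by
    rw [hgH, BettiUniverse.pullHodgeHom_toLinearMap]
  have hstabF : ∀ x ∈ H.F ((n : ℤ) - q + 1), gC x ∈ H.F ((n : ℤ) - q + 1) := fun x hx ↦ by
    rw [← hgH']; exact gH.baseChange_mem_F _ hx
  have hstabW : ∀ x ∈ H.piece ((n : ℤ) - q) q, gC x ∈ H.piece ((n : ℤ) - q) q := fun x hx ↦ by
    rw [← hgH']; exact gH.baseChange_mem_piece hx
  have X4 := finrank_eigenspace_inf_sup_eq_of_disjoint gC hdisj hstabF hstabW 1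
  rw [← hpiece, X1, X2] at X4
  -- the sums in (X1), (X2) are direct: residues are primitive, `L ∩ Prim = 0`
  have hdj1 : S1.map ρ ⊓ (L ⊓ H.F ((n : ℤ) - q)) = ⊥ := by
    rw [eq_bot_iff]
    rintro x ⟨hx, hxL, -⟩
    obtain ⟨P, hP, rfl⟩ := Submodule.mem_map.mp hx
    rw [Submodule.mem_bot]
    exact hLPrim _ hxL (hρPrim P hP.2)
  have hdj2 : J1.map ρ ⊓ (L ⊓ H.F ((n : ℤ) - q + 1)) = ⊥ := by
    rw [eq_bot_iff]
    rintro x ⟨hx, hxL, -⟩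
    obtain ⟨P, hP, rfl⟩ := Submodule.mem_map.mp hx
    rw [Submodule.mem_bot]
    exact hLPrim _ hxL (hρPrim P hP.2.2)
  have e1 := Submodule.finrank_sup_add_finrank_inf_eq (S1.map ρ) (L ⊓ H.F ((n : ℤ) - q))
  have e2 := Submodule.finrank_sup_add_finrank_inf_eq (J1.map ρ) (L ⊓ H.F ((n : ℤ) - q + 1))
  rw [hdj1, finrank_bot, add_zero] at e1
  rw [hdj2, finrank_bot, add_zero] at e2
  -- the hyperplane line in the filtration: `L ⊆ F^p` for `p ≤ m`, `L ∩ F^p = 0` for `p ≥ m + 1`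
  have hLle : ∀ p : ℤ, p ≤ m → L ⊓ H.F p = L := fun p hpm ↦
    inf_eq_left.mpr (hLF.trans (H.antitone_F hpm))
  have hLbot : ∀ p : ℤ, (m : ℤ) + 1 ≤ p → L ⊓ H.F p = ⊥ := fun p hpm ↦
    le_bot_iff.mp (le_trans (inf_le_inf_left _ (H.antitone_F hpm)) hLF1.le)
  have hLq : Module.finrank ℂ ↥(L ⊓ H.F ((n : ℤ) - q)) = if m ≤ q then 1 else 0 := by
    split_ifs with hmq
    · rw [hLle _ (by omega), hLdim]
    · rw [hLbot _ (by omega), finrank_bot]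
  have hLq1 : Module.finrank ℂ ↥(L ⊓ H.F ((n : ℤ) - q + 1)) = if m + 1 ≤ q then 1 else 0 := by
    split_ifs with hmq
    · rw [hLle _ (by omega), hLdim]
    · rw [hLbot _ (by omega), finrank_bot]
  -- rank–nullity
  haveI : FiniteDimensional ℂ ↥S1 := Submodule.finiteDimensional_inf_right _ _
  haveI : FiniteDimensional ℂ ↥J1 := Submodule.finiteDimensional_of_le hJ1_le
  have rS := finrank_map_add_finrank_inf_ker ρ S1
  have rJ := finrank_map_add_finrank_inf_ker ρ J1
  rw [X3] at rS
  have hle1 : Module.finrank ℂ ↥J1 ≤ Module.finrank ℂ ↥S1 := Submodule.finrank_mono hJ1_le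
  -- collect the identities with syntactically identical atoms
  have d1 : Module.finrank ℂ ↥(S1.map ρ ⊔ L ⊓ H.F ((n : ℤ) - q)) =
      Module.finrank ℂ ↥(J1.map ρ ⊔ L ⊓ H.F ((n : ℤ) - q + 1)) +
        Module.finrank ℂ ↥(Module.End.eigenspace gC 1 ⊓ H.piece ((n : ℤ) - q) q) := X4
  have d2 : Module.finrank ℂ ↥(S1.map ρ) + Module.finrank ℂ ↥(L ⊓ H.F ((n : ℤ) - q)) =
      Module.finrank ℂ ↥(S1.map ρ ⊔ L ⊓ H.F ((n : ℤ) - q)) := e1.symm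
  have d3 : Module.finrank ℂ ↥(J1.map ρ) + Module.finrank ℂ ↥(L ⊓ H.F ((n : ℤ) - q + 1)) =
      Module.finrank ℂ ↥(J1.map ρ ⊔ L ⊓ H.F ((n : ℤ) - q + 1)) := e2.symm
  have d4 : Module.finrank ℂ ↥(S1.map ρ) + Module.finrank ℂ ↥(J1 ⊓ LinearMap.ker ρ) =
      Module.finrank ℂ ↥S1 := rS
  have d5 : Module.finrank ℂ ↥(J1.map ρ) + Module.finrank ℂ ↥(J1 ⊓ LinearMap.ker ρ) =
      Module.finrank ℂ ↥J1 := rJ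
  have d6 : Module.finrank ℂ ↥(L ⊓ H.F ((n : ℤ) - q)) = if m ≤ q then 1 else 0 := hLq
  have d7 : Module.finrank ℂ ↥(L ⊓ H.F ((n : ℤ) - q + 1)) = if m + 1 ≤ q then 1 else 0 := hLq1
  clear X4 e1 e2 rS rJ hLq hLq1
  by_cases hqm : q = m
  · rw [if_pos hqm]
    rw [if_pos (by omega)] at d6
    rw [if_neg (by omega)] at d7
    omega
  · rw [if_neg hqm]
    by_cases hmq : m ≤ q
    · rw [if_pos hmq] at d6
      rw [if_pos (by omega)] at d7
      omega
    · rw [if_neg hmq] at d6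
      rw [if_neg (by omega)] at d7
      omega


end HodgeTheory

end Literature.AlgebraicGeometry.HodgeTheory

end
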